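import Summits.KontsevichZagierPeriods.KontsevichZagierPeriods.Theorems.RootDecompWalshStrataEtypeCorners

/-!
# Root decomposition (Walsh strata), part 62 — E-type corners: the total conic-wall terminal and sector (gen 10, §62)

Route `RootDecompWalshStrata`, leaf `QuadricBakerDescent` (stmt-27597), residual R-Eθ.  Completes part 61:

* `InBaker.psection_dpoint` — `k ≠ 0`, `c ≥ 0`, `q₀² ≠ c`, `δe ≠ 0`, `4δeδg = δf²`: the identity
  `4δeδg − δf² = −4k(cδe + a²κ₀κ₁q₀²)` forces `δe < 0`; by `ConicWall.sq_of_wall` the wall conic is the single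
  point `(X₀, Y₀)`, so a boundary section on it is null or empty;
* `InBaker.psection_cwall'` — the conic-wall section terminal with NO side condition (`κ₀, κ₁ > 0`): dispatch on
  `k = 0` (`InBaker.psection_conic_k0` / `InBaker.psection_hpair`), the good stratum (`InBaker.psection_cwall`),
  the centre stratum (`InBaker.psection_centre`) and the double root (`InBaker.psection_dpoint`);
* `InBaker.of_psector_cwalls'` — the E-type sector piece with line and adapted conic walls, now for EVERY wall
  list (the landed `InBaker.of_psector_cwalls` minus its hypotheses `hq`, `hc`): same cover, the conic-wall
  pieces go to `InBaker.psection_cwall'`.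
[KontsevichZagier2001 §1.2 rules (1)–(3); BCR1998 §2.2; this node]
-/

noncomputable section

open Set MeasureTheory MvPolynomial Literature.NumberTheory.Transcendental
open Literature.ModelTheory.ExponentialFields (IsSemialgebraic)

namespace Summit.KontsevichZagierPeriods.RootDecompWalshStrata.ConicDescent.BallCube

variable {κ₀ κ₁ : ℚ}

/-! #### 62.1 The double-root radicand: the wall conic is a point -/

/-- **DOUBLE-ROOT RADICAND OFF THE CENTRE** (`k ≠ 0`, `c ≥ 0`, `q₀² ≠ c`, `δe ≠ 0`, `4δeδg = δf²`).  The
identity `4δeδg − δf² = −4k(cδe + a²κ₀κ₁q₀²)` gives `cδe = −a²κ₀κ₁q₀²`, hence `q₀ ≠ 0`, `c > 0`, `δe < 0`; along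
the wall `(kX − q₁L(Y))² = δ(Y) = δe(Y − Y₀)²` (`ConicWall.sq_of_wall`) forces `Y = Y₀`, `X = X₀`: the wall conic
is the single point `(X₀, Y₀)` and a boundary section on it is null (`X₀t = Y₀`) or empty.
[KontsevichZagier2001 §1.2 rule (1); this node] -/
theorem InBaker.psection_dpoint (hκ : 0 < κ₀ ∧ 0 < κ₁) (a c : ℚ) (ha : a ≠ 0) (q : Wall)
    (hk : a * κ₀ - q.k1 ^ 2 ≠ 0) (hc : 0 ≤ c) (hce : q.k0 ^ 2 ≠ c)
    (hδe : (cwall κ₀ κ₁ a c q).δe ≠ 0)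
    (hdg : (cwall κ₀ κ₁ a c q).δg - (cwall κ₀ κ₁ a c q).δf ^ 2 / (4 * (cwall κ₀ κ₁ a c q).δe) = 0)
    {S : Set (Fin 1 → ℝ)} (ζ : (Fin 1 → ℝ) → ℝ) (hζ : ∀ x ∈ S, 0 < ζ x ∧ ζ x ^ 2 ≤ 1)
    (hwall : ∀ x ∈ S, (a : ℝ) * ζ x ^ 2 + c =
      (q.k0 + (q.k1 + q.k2 * x 0) * (ζ x / pN κ₀ κ₁ (x 0))) ^ 2)
    (r₁ : KZ.IntegralRep 1) (hr₁ : r₁.domain ⊆ S) :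
    InBaker (KZ.of r₁) := by
  have hκ' : 0 < κ₀ ∧ 0 ≤ κ₁ := ⟨hκ.1, hκ.2.le⟩
  -- the algebra over `ℚ`
  have hdg' : (cwall κ₀ κ₁ a c q).δg = (cwall κ₀ κ₁ a c q).δf ^ 2 / (4 * (cwall κ₀ κ₁ a c q).δe) :=
    sub_eq_zero.1 hdg
  have h4 : 4 * (cwall κ₀ κ₁ a c q).δe * (cwall κ₀ κ₁ a c q).δg - (cwall κ₀ κ₁ a c q).δf ^ 2 = 0 := by
    have h := div_mul_cancel₀ ((cwall κ₀ κ₁ a c q).δf ^ 2) (mul_ne_zero four_ne_zero hδe)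
    rw [hdg']
    linear_combination h
  have hid : 4 * (cwall κ₀ κ₁ a c q).δe * (cwall κ₀ κ₁ a c q).δg - (cwall κ₀ κ₁ a c q).δf ^ 2 =
      -4 * (a * κ₀ - q.k1 ^ 2) * (c * (cwall κ₀ κ₁ a c q).δe + a ^ 2 * κ₀ * κ₁ * q.k0 ^ 2) := by
    simp only [ConicWall.δe, ConicWall.δf, ConicWall.δg, cwall_k, cwall_κ₀, cwall_κ₁, cwall_a, cwall_c,
      cwall_l₀, cwall_l₂]
    ring
  have hE : c * (cwall κ₀ κ₁ a c q).δe = -(a ^ 2 * κ₀ * κ₁ * q.k0 ^ 2) := by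
    rw [hid] at h4
    have h5 : c * (cwall κ₀ κ₁ a c q).δe + a ^ 2 * κ₀ * κ₁ * q.k0 ^ 2 = 0 := by
      rcases mul_eq_zero.1 h4 with h6 | h6
      · exfalso
        rcases mul_eq_zero.1 h6 with h7 | h7
        · norm_num at h7
        · exact hk h7
      · exact h6
    linear_combination h5
  have hk0 : q.k0 ≠ 0 := by
    intro h0
    rw [h0, zero_pow two_ne_zero, mul_zero, neg_zero] at hE
    rw [h0, zero_pow two_ne_zero] at hce
    rcases mul_eq_zero.1 hE with h | h
    · exact hce h.symm
    · exact hδe h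
  have ha2 : 0 < a ^ 2 := by rw [sq]; exact mul_self_pos.2 ha
  have hq2 : 0 < q.k0 ^ 2 := by rw [sq]; exact mul_self_pos.2 hk0
  have hrhs : 0 < a ^ 2 * κ₀ * κ₁ * q.k0 ^ 2 := by
    have := hκ.1
    have := hκ.2
    positivity
  have hδneg : (cwall κ₀ κ₁ a c q).δe < 0 := by
    refine not_le.1 fun h => ?_
    have : 0 ≤ c * (cwall κ₀ κ₁ a c q).δe := mul_nonneg hc h
    linarith
  have hδneg' : ((cwall κ₀ κ₁ a c q).δe : ℝ) < 0 := by exact_mod_cast hδneg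
  have hδe' : ((cwall κ₀ κ₁ a c q).δe : ℝ) ≠ 0 := by exact_mod_cast hδe
  have hk' : (a : ℝ) * κ₀ - (q.k1 : ℝ) ^ 2 ≠ 0 := by
    have h : ((a * κ₀ - q.k1 ^ 2 : ℚ) : ℝ) ≠ 0 := by exact_mod_cast hk
    push_cast at h
    exact h
  -- the point `(X₀, Y₀)`
  obtain ⟨Y₀, hY₀⟩ : ∃ Y₀ : ℚ, Y₀ = -(cwall κ₀ κ₁ a c q).δf / (2 * (cwall κ₀ κ₁ a c q).δe) := ⟨_, rfl⟩
  obtain ⟨X₀, hX₀⟩ : ∃ X₀ : ℚ, X₀ = q.k1 * (q.k0 + q.k2 * Y₀) / (a * κ₀ - q.k1 ^ 2) := ⟨_, rfl⟩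
  have hpt : ∀ x ∈ S, secX κ₀ κ₁ ζ x * x 0 = Y₀ ∧ secX κ₀ κ₁ ζ x = X₀ := by
    intro x hx
    have hsq : secE (cwall κ₀ κ₁ a c q) ζ x ^ 2 =
        (cwall κ₀ κ₁ a c q).δ (secX κ₀ κ₁ ζ x * x 0) := by
      refine (cwall κ₀ κ₁ a c q).sq_of_wall (secX κ₀ κ₁ ζ x) (secX κ₀ κ₁ ζ x * x 0) ?_
      rw [cwall_κ₀, cwall_κ₁, cwall_a, cwall_c, cwall_l₀, cwall_l₁, cwall_l₂, norm_secX hκ' ζ x,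
        hwall x hx, secX]
      ring
    rw [(cwall κ₀ κ₁ a c q).δ_eq_qD, qD] at hsq
    have hdgR : ((cwall κ₀ κ₁ a c q).δg : ℝ) =
        ((cwall κ₀ κ₁ a c q).δf : ℝ) ^ 2 / (4 * ((cwall κ₀ κ₁ a c q).δe : ℝ)) := by
      exact_mod_cast hdg'
    have h5 : secE (cwall κ₀ κ₁ a c q) ζ x ^ 2 =
        (cwall κ₀ κ₁ a c q).δe * (secX κ₀ κ₁ ζ x * x 0 - Y₀) ^ 2 := by
      rw [hsq, hdgR, hY₀]
      push_cast
      field_simp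
      ring
    have hs : (secX κ₀ κ₁ ζ x * x 0 - Y₀) ^ 2 = 0 :=
      le_antisymm (by nlinarith [sq_nonneg (secE (cwall κ₀ κ₁ a c q) ζ x)]) (sq_nonneg _)
    have hY : secX κ₀ κ₁ ζ x * x 0 = Y₀ := by
      have := pow_eq_zero_iff two_ne_zero |>.1 hs
      linarith
    have hE0 : secE (cwall κ₀ κ₁ a c q) ζ x = 0 := by
      have h6 : secE (cwall κ₀ κ₁ a c q) ζ x ^ 2 = 0 := by rw [h5, hY]; ring
      exact pow_eq_zero_iff two_ne_zero |>.1 h6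
    refine ⟨hY, ?_⟩
    simp only [secE, ConicWall.L, cwall_k, cwall_κ₀, cwall_κ₁, cwall_l₀, cwall_l₁, cwall_l₂] at hE0
    rw [hY] at hE0
    rw [hX₀]
    push_cast at hE0 ⊢
    rw [eq_div_iff hk']
    linear_combination hE0
  by_cases hX0 : X₀ = 0
  · -- `X₀ = 0`: the section is empty (`X = ζ/N > 0`)
    refine InBaker.of_domain_eq_empty r₁ (Set.subset_empty_iff.1 fun v hv => ?_)
    exfalso
    have hxS := hr₁ hv
    obtain ⟨hz, -⟩ := hζ v hxS
    have h := (hpt v hxS).2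
    rw [hX0, Rat.cast_zero, secX] at h
    exact (div_pos hz (pN_pos hκ' (v 0))).ne' h
  · -- the null slope `X₀t = Y₀`
    refine InBaker.of_subset_zeroSet r₁ (C X₀ * X 0 + C (-Y₀) : MvPolynomial (Fin 1) ℚ)
      ⟨fun _ => ((Y₀ + 1) / X₀ : ℚ), ?_⟩ fun v hv => ?_
    · simp only [map_add, map_mul, map_neg, MvPolynomial.aeval_C, MvPolynomial.aeval_X, eq_ratCast]
      have hX0' : (X₀ : ℝ) ≠ 0 := by exact_mod_cast hX0
      have hval : (X₀ : ℝ) * (((Y₀ + 1) / X₀ : ℚ) : ℝ) + -(Y₀ : ℝ) = 1 := by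
        rw [mul_comm, Rat.cast_div, Rat.cast_add, Rat.cast_one, div_mul_cancel₀ _ hX0']
        ring
      rw [hval]
      exact one_ne_zero
    · obtain ⟨hY, hX⟩ := hpt v (hr₁ hv)
      simp only [map_add, map_mul, map_neg, MvPolynomial.aeval_C, MvPolynomial.aeval_X, eq_ratCast]
      rw [← hX, ← hY]
      ring

/-! #### 62.2 The total dispatcher -/

/-- **CONIC-WALL SECTION, NO SIDE CONDITION** (`κ₀, κ₁ > 0`, `a ≠ 0`, any `c`, any adapted conic wall).
`k = 0`: `InBaker.psection_conic_k0` (`L ≢ 0`) or `InBaker.psection_hpair`; `k ≠ 0`: the landed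
`InBaker.psection_cwall` on the good stratum, else `InBaker.psection_centre` (`q₀² = c`) or
`InBaker.psection_dpoint` (double root off the centre). [this node] -/
theorem InBaker.psection_cwall' (hκ : 0 < κ₀ ∧ 0 < κ₁) (γ a c : ℚ) (ha : a ≠ 0) (q : Wall)
    {S : Set (Fin 1 → ℝ)} (ζ : (Fin 1 → ℝ) → ℝ)
    (hζsa : IsSemialgebraicFunOn ℚ S ζ) (hS01 : ∀ x ∈ S, 0 ≤ x 0 ∧ x 0 ≤ 1)
    (hζ : ∀ x ∈ S, 0 < ζ x ∧ ζ x ^ 2 ≤ 1)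
    (hwall : ∀ x ∈ S, (a : ℝ) * ζ x ^ 2 + c =
      (q.k0 + (q.k1 + q.k2 * x 0) * (ζ x / pN κ₀ κ₁ (x 0))) ^ 2)
    (r₁ : KZ.IntegralRep 1) (hr₁ : r₁.domain ⊆ S)
    (hint : EqOn r₁.integrand (fun x => ppot κ₀ κ₁ γ a c (Fin.snoc x (ζ x))) r₁.domain) :
    InBaker (KZ.of r₁) := by
  have hκ' : 0 < κ₀ ∧ 0 ≤ κ₁ := ⟨hκ.1, hκ.2.le⟩
  rcases eq_or_ne (a * κ₀ - q.k1 ^ 2) 0 with hk0 | hkne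
  · by_cases hL : q.k0 = 0 ∧ q.k2 = 0
    · exact InBaker.psection_hpair hκ γ a c ha q hk0 hL.1 hL.2 ζ hS01 hζ hwall r₁ hr₁ hint
    · exact InBaker.psection_conic_k0 (cwall κ₀ κ₁ a c q) hκ' γ ha hk0 (not_and_or.1 hL) ζ hζsa hS01
        hζ hwall r₁ hr₁ hint
  · by_cases hg : c < 0 ∨ (q.k0 ^ 2 ≠ c ∧ ((cwall κ₀ κ₁ a c q).δe ≠ 0 →
        (cwall κ₀ κ₁ a c q).δg - (cwall κ₀ κ₁ a c q).δf ^ 2 / (4 * (cwall κ₀ κ₁ a c q).δe) ≠ 0))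
    · exact InBaker.psection_cwall hκ' γ a c ha q (hg.imp_right fun h => ⟨hκ.2, h⟩) (Or.inl hkne)
        ζ hζsa hS01 hζ hwall r₁ hr₁ hint
    · have hc : 0 ≤ c := not_lt.1 fun h => hg (Or.inl h)
      by_cases hce : q.k0 ^ 2 = c
      · exact InBaker.psection_centre hκ γ a c ha q hkne hce ζ hζ hwall r₁ hr₁ hint
      · have h' : ¬((cwall κ₀ κ₁ a c q).δe ≠ 0 → (cwall κ₀ κ₁ a c q).δg -
            (cwall κ₀ κ₁ a c q).δf ^ 2 / (4 * (cwall κ₀ κ₁ a c q).δe) ≠ 0) :=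
          fun h => hg (Or.inr ⟨hce, h⟩)
        have hδe : (cwall κ₀ κ₁ a c q).δe ≠ 0 := fun h0 => h' fun h => absurd h0 h
        have hdg : (cwall κ₀ κ₁ a c q).δg -
            (cwall κ₀ κ₁ a c q).δf ^ 2 / (4 * (cwall κ₀ κ₁ a c q).δe) = 0 := by
          by_contra hne
          exact h' fun _ => hne
        exact InBaker.psection_dpoint hκ a c ha q hkne hc hce hδe hdg ζ hζ hwall r₁ hr₁

/-! #### 62.3 The sector theorem with line and conic walls, every wall list -/

/-- **E-TYPE SECTOR PIECE WITH LINE AND ADAPTED CONIC WALLS — EVERY WALL LIST** (`κ₀, κ₁ > 0`).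
`[T, γ√(a(κ₀X² + κ₁Y²) + c)] ∈ InBaker` for an open piece `T` of the normalised sector whose boundary off the
axis `X = 0` (inside a closed `C` within the closed sector) lies on the conic `a(κ₀X² + κ₁Y²) + c = 0`, on
finitely many rational lines `ℓ i` (those through the centre genuine) and on finitely many adapted conic walls
`a(κ₀X² + κ₁Y²) + c = (q j)(X, Y)²` — with no restriction on the conic walls.  The landed
`InBaker.of_psector_cwalls` verbatim, its conic-wall pieces sent to the total terminal `InBaker.psection_cwall'`.
[KontsevichZagier2001 §1.2 rules (1)–(3); BCR1998 §2.2; this node] -/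
theorem InBaker.of_psector_cwalls' (hκ₁ : 0 < κ₀ ∧ 0 < κ₁) (γ a c : ℚ) (ha : a ≠ 0)
    {n m : ℕ} (ℓ : Fin n → Wall) (hℓ0 : ∀ i, (ℓ i).k0 = 0 → (ℓ i).k1 ≠ 0 ∨ (ℓ i).k2 ≠ 0)
    (q : Fin m → Wall) (σ : KZ.IntegralRep 2) (hσo : IsOpen σ.domain)
    (hσT : σ.domain ⊆ {w | 0 < w 1 ∧ w 1 < w 0 ∧ (κ₀ : ℝ) * w 0 ^ 2 + κ₁ * w 1 ^ 2 < 1})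
    (hD : ∀ w ∈ σ.domain, 0 < (a : ℝ) * (κ₀ * w 0 ^ 2 + κ₁ * w 1 ^ 2) + c)
    (hσi : ∀ w ∈ σ.domain, σ.integrand w = ellW κ₀ κ₁ γ a c w)
    {C : Set (Fin 2 → ℝ)} (hC : IsClosed C) (hσC : σ.domain ⊆ C)
    (hCsec : ∀ w ∈ C, 0 ≤ w 1 ∧ w 1 ≤ w 0 ∧ (κ₀ : ℝ) * w 0 ^ 2 + κ₁ * w 1 ^ 2 ≤ 1)
    (hwall : ∀ w ∈ C, w ∉ σ.domain → 0 < w 0 →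
      (a : ℝ) * (κ₀ * w 0 ^ 2 + κ₁ * w 1 ^ 2) + c = 0 ∨ (∃ i, (ℓ i).eval (w 0) (w 1) = 0) ∨
        ∃ j, (a : ℝ) * (κ₀ * w 0 ^ 2 + κ₁ * w 1 ^ 2) + c = ((q j).eval (w 0) (w 1)) ^ 2) :
    InBaker (KZ.of σ) := by
  classical
  have hκ : 0 < κ₀ ∧ 0 ≤ κ₁ := ⟨hκ₁.1, hκ₁.2.le⟩
  have snoc2_zero''' : ∀ (x : Fin 1 → ℝ) (t : ℝ), (Fin.snoc x t : Fin 2 → ℝ) 0 = x 0 := fun _ _ => rfl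
  have snoc2_one''' : ∀ (x : Fin 1 → ℝ) (t : ℝ), (Fin.snoc x t : Fin 2 → ℝ) 1 = t := fun _ _ => rfl
  have hκ0 : (0 : ℝ) < κ₀ := by exact_mod_cast hκ.1
  have hκ1 : (0 : ℝ) ≤ κ₁ := by exact_mod_cast hκ.2
  have ha' : (a : ℝ) ≠ 0 := by exact_mod_cast ha
  refine InBaker.of_psector hκ γ a c ha σ hσo hσT hD (fun w hw => by rw [hσi w hw, ellW])
    fun S ζ hS hζ _ hfr r₁ hr₁ hr₁i => ?_
  -- what a section point looks like
  have hF : ∀ x ∈ S, 0 ≤ ζ x ∧ (0 < ζ x → (0 ≤ x 0 ∧ x 0 ≤ 1) ∧ ζ x ^ 2 ≤ 1 ∧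
      ((a : ℝ) * ζ x ^ 2 + c = 0 ∨
        (∃ i, ζ x * ((ℓ i).k1 + (ℓ i).k2 * x 0) = -(ℓ i).k0 * pN κ₀ κ₁ (x 0)) ∨
        ∃ j, (a : ℝ) * ζ x ^ 2 + c =
          ((q j).k0 + ((q j).k1 + (q j).k2 * x 0) * (ζ x / pN κ₀ κ₁ (x 0))) ^ 2)) := fun x hx => by
    obtain ⟨h0, h⟩ := psector_frontier_facts hκ hσo hC hσC hCsec (hfr x hx)
    refine ⟨h0, fun hz => ?_⟩
    obtain ⟨ht, hz1, w, hwC, hwT, hX, hY, hsq, hXN⟩ := h hz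
    refine ⟨ht, hz1, ?_⟩
    have hN := pN_pos hκ (x 0)
    rcases hwall w hwC hwT hX with hDw | ⟨i, hi⟩ | ⟨j, hj⟩
    · left
      rw [← hsq]
      linarith
    · right; left
      refine ⟨i, ?_⟩
      rw [Wall.eval, hY] at hi
      rw [← hXN]
      linear_combination (pN κ₀ κ₁ (x 0)) * hi
    · right; right
      refine ⟨j, ?_⟩
      rw [Wall.eval, hsq, hY] at hj
      have hw0 : w 0 = ζ x / pN κ₀ κ₁ (x 0) := by rw [← hXN]; field_simp
      rw [hj, hw0]
      ring
  -- the cover of `S` by the pulled-back walls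
  have hz0 : IsSemialgebraicFunOn ℚ S fun _ => (0 : ℝ) :=
    (isSemialgebraicFunOn_ratCast hS 0).congr fun _ _ => by simp
  have hN : IsSemialgebraicFunOn ℚ S fun x => pN κ₀ κ₁ (x 0) :=
    (IsSemialgebraicFunOn.sqrt_holds (isSemialgebraicFunOn_aeval hS
      (MvPolynomial.C κ₀ + MvPolynomial.C κ₁ * X 0 ^ 2 : MvPolynomial (Fin 1) ℚ))).congr
      fun x _ => by simp [pN, pW]
  have hQ : IsSemialgebraicFunOn ℚ S fun x => (a : ℝ) * ζ x ^ 2 + c :=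
    (((isSemialgebraicFunOn_ratCast hS a).mul_holds (hζ.mul_holds hζ)).add_holds
      (isSemialgebraicFunOn_ratCast hS c)).congr fun x _ => by
        simp only [Pi.add_apply, Pi.mul_apply]; ring
  have hPc : IsSemialgebraic ℚ {x | x ∈ S ∧ ζ x = 0} := isSemialgebraic_sep_eq hζ hz0
  have hPq : IsSemialgebraic ℚ {x | x ∈ S ∧ (a : ℝ) * ζ x ^ 2 + c = 0} :=
    isSemialgebraic_sep_eq hQ hz0
  have hPl : ∀ i, IsSemialgebraic ℚ ({x | x ∈ S ∧
      ζ x * ((ℓ i).k1 + (ℓ i).k2 * x 0) = -(ℓ i).k0 * pN κ₀ κ₁ (x 0)} \ {x | x ∈ S ∧ ζ x = 0}) :=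
    fun i => (isSemialgebraic_sep_eq
      ((hζ.mul_holds (isSemialgebraicFunOn_aeval hS
        (MvPolynomial.C (ℓ i).k1 + MvPolynomial.C (ℓ i).k2 * X 0 :
          MvPolynomial (Fin 1) ℚ))).congr fun x _ => by
          simp only [Pi.mul_apply, map_add, map_mul, MvPolynomial.aeval_C, MvPolynomial.aeval_X,
            eq_ratCast])
      (((isSemialgebraicFunOn_ratCast hS (-(ℓ i).k0)).mul_holds hN).congr fun x _ => by
          simp only [Pi.mul_apply]; push_cast; ring)).diff hPc
  have hPw : ∀ j, IsSemialgebraic ℚ ({x | x ∈ S ∧ (a : ℝ) * ζ x ^ 2 + c =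
      ((q j).k0 + ((q j).k1 + (q j).k2 * x 0) * (ζ x / pN κ₀ κ₁ (x 0))) ^ 2} \
        {x | x ∈ S ∧ ζ x = 0}) := fun j => by
    have hlin : IsSemialgebraicFunOn ℚ S fun x =>
        ((q j).k0 : ℝ) + ((q j).k1 + (q j).k2 * x 0) * (ζ x / pN κ₀ κ₁ (x 0)) :=
      ((isSemialgebraicFunOn_ratCast hS (q j).k0).add_holds ((isSemialgebraicFunOn_aeval hS
        (MvPolynomial.C (q j).k1 + MvPolynomial.C (q j).k2 * X 0 : MvPolynomial (Fin 1) ℚ)).mul_holds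
        (hζ.div hN fun x _ => (pN_pos hκ (x 0)).ne'))).congr fun x _ => by
          simp only [Pi.add_apply, Pi.mul_apply, map_add, map_mul, MvPolynomial.aeval_C,
            MvPolynomial.aeval_X, eq_ratCast]
    exact (isSemialgebraic_sep_eq hQ (hlin.mul_holds hlin |>.congr fun x _ => by
      simp only [Pi.mul_apply]; ring)).diff hPc
  have hSr : r₁.domain ⊆ S := hr₁.le
  refine InBaker.of_cover' r₁
    (fun o : Option (Option (Fin n ⊕ Fin m)) => match o with
      | none => {x | x ∈ S ∧ ζ x = 0}
      | some none => {x | x ∈ S ∧ (a : ℝ) * ζ x ^ 2 + c = 0}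
      | some (some (Sum.inl i)) => {x | x ∈ S ∧
          ζ x * ((ℓ i).k1 + (ℓ i).k2 * x 0) = -(ℓ i).k0 * pN κ₀ κ₁ (x 0)} \ {x | x ∈ S ∧ ζ x = 0}
      | some (some (Sum.inr j)) => {x | x ∈ S ∧ (a : ℝ) * ζ x ^ 2 + c =
          ((q j).k0 + ((q j).k1 + (q j).k2 * x 0) * (ζ x / pN κ₀ κ₁ (x 0))) ^ 2} \
            {x | x ∈ S ∧ ζ x = 0})
    (fun o => ?_) (fun x hx => ?_) fun o T hT hTr hTA => ?_
  · rcases o with _ | ⟨_ | ⟨i | j⟩⟩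
    · exact hPc
    · exact hPq
    · exact hPl i
    · exact hPw j
  · have hxS : x ∈ S := hSr hx
    obtain ⟨h0, h⟩ := hF x hxS
    rcases h0.eq_or_lt with hz | hz
    · exact mem_iUnion.2 ⟨none, hxS, hz.symm⟩
    · obtain ⟨-, -, hq' | ⟨i, hi⟩ | ⟨j, hj⟩⟩ := h hz
      · exact mem_iUnion.2 ⟨some none, hxS, hq'⟩
      · exact mem_iUnion.2 ⟨some (some (Sum.inl i)), ⟨hxS, hi⟩, fun h' => hz.ne' h'.2⟩
      · exact mem_iUnion.2 ⟨some (some (Sum.inr j)), ⟨hxS, hj⟩, fun h' => hz.ne' h'.2⟩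
  · have hTS : T ⊆ S := fun v hv => hSr (hTr hv)
    rcases o with _ | ⟨_ | ⟨i | j⟩⟩
    · -- the centre segment `r = 0`: `P(t, 0) = (γ c√c/(3a))/W(t)`
      have hTz : ∀ v ∈ T, ζ v = 0 := fun v hv => (hTA hv).2
      have hc0 : (a : ℝ) * 0 ^ 2 + c = c := by ring
      by_cases hcp : 0 < c
      · refine InBaker.sqrt_const_even c hcp (Polynomial.C (γ * c / (3 * a)))
          (Polynomial.C κ₀ + Polynomial.C κ₁ * Polynomial.X) _ (fun v _ => ?_) fun v hv => ?_
        · have h3 : (0 : ℝ) < κ₀ + κ₁ * v 0 ^ 2 := by nlinarith [mul_nonneg hκ1 (sq_nonneg (v 0))]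
          simp only [map_mul, map_add, Polynomial.aeval_C, Polynomial.aeval_X, eq_ratCast]
          exact h3.ne'
        · have h3 : (0 : ℝ) < κ₀ + κ₁ * v 0 ^ 2 := by nlinarith [mul_nonneg hκ1 (sq_nonneg (v 0))]
          have hq : qD 0 0 c (v 0) = c := by simp [qD]
          rw [KZ.IntegralRep.integrand_restrict, hr₁i (hTS hv)]
          beta_reduce
          rw [ppot, snoc2_zero''', snoc2_one''', hTz v hv, ph, hc0, hq]
          simp only [map_mul, map_add, Polynomial.aeval_C, Polynomial.aeval_X, eq_ratCast]
          push_cast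
          field_simp
      · have hc' : (c : ℝ) ≤ 0 := by exact_mod_cast not_lt.1 hcp
        refine InBaker.of_mem_relations (KZ.of_mem_relations_of_eqOn_zero _ fun v hv => ?_)
        rw [KZ.IntegralRep.integrand_restrict, hr₁i (hTS hv)]
        beta_reduce
        rw [ppot, snoc2_zero''', snoc2_one''', hTz v hv, ph, hc0, Real.sqrt_eq_zero'.2 hc']
        simp
    · -- the conic wall: the primitive vanishes
      refine InBaker.of_mem_relations (KZ.of_mem_relations_of_eqOn_zero _ fun v hv => ?_)
      have hq' : (a : ℝ) * ζ v ^ 2 + c = 0 := (hTA hv).2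
      rw [KZ.IntegralRep.integrand_restrict, hr₁i (hTS hv)]
      beta_reduce
      rw [ppot, snoc2_zero''', snoc2_one''', ph, hq']
      simp
    · -- a line wall
      have hTl : ∀ v ∈ T, v ∈ S ∧ 0 < ζ v ∧
          ζ v * ((ℓ i).k1 + (ℓ i).k2 * v 0) = -(ℓ i).k0 * pN κ₀ κ₁ (v 0) := fun v hv => by
        obtain ⟨⟨hvS, hw⟩, hnz⟩ := hTA hv
        have hz : 0 < ζ v := ((hF v hvS).1).lt_of_ne fun h => hnz ⟨hvS, h.symm⟩
        exact ⟨hvS, hz, hw⟩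
      by_cases hk : (ℓ i).k0 = 0
      · -- through the centre: the vertical wall `k₁ + k₂t = 0` (null)
        have hne : ∃ x : Fin 1 → ℝ, aeval x (MvPolynomial.C (ℓ i).k1 +
            MvPolynomial.C (ℓ i).k2 * X 0 : MvPolynomial (Fin 1) ℚ) ≠ 0 := by
          rcases hℓ0 i hk with h1 | h2
          · refine ⟨fun _ => 0, ?_⟩
            simp only [map_add, map_mul, MvPolynomial.aeval_C, MvPolynomial.aeval_X, eq_ratCast,
              mul_zero, add_zero]
            exact_mod_cast h1
          · refine ⟨fun _ => ((1 - (ℓ i).k1) / (ℓ i).k2 : ℚ), ?_⟩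
            simp only [map_add, map_mul, MvPolynomial.aeval_C, MvPolynomial.aeval_X, eq_ratCast]
            have h2' : ((ℓ i).k2 : ℝ) ≠ 0 := by exact_mod_cast h2
            rw [show ((ℓ i).k1 : ℝ) + (ℓ i).k2 * (((1 - (ℓ i).k1) / (ℓ i).k2 : ℚ) : ℝ) = 1 by
              push_cast; field_simp; ring]
            exact one_ne_zero
        refine InBaker.of_subset_zeroSet _
          (MvPolynomial.C (ℓ i).k1 + MvPolynomial.C (ℓ i).k2 * X 0 : MvPolynomial (Fin 1) ℚ)
          hne fun v hv => ?_
        obtain ⟨-, hz, hw⟩ := hTl v hv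
        rw [hk] at hw
        push_cast at hw
        simp only [neg_zero, zero_mul, mul_eq_zero] at hw
        rcases hw with h | h
        · exact absurd h hz.ne'
        · simp only [map_add, map_mul, MvPolynomial.aeval_C, MvPolynomial.aeval_X, eq_ratCast]
          exact h
      · -- a line off the centre: the Euler terminal and its degenerate strata
        exact InBaker.psection_line hκ γ a c ha (ℓ i).k0 (ℓ i).k1 (ℓ i).k2 hk (S := T) ζ
          (fun v hv => ((hF v (hTl v hv).1).2 (hTl v hv).2.1).1)
          (fun v hv => ⟨(hTl v hv).2.1, ((hF v (hTl v hv).1).2 (hTl v hv).2.1).2.1⟩)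
          (fun v hv => (hTl v hv).2.2) _ subset_rfl fun v hv => by
            rw [KZ.IntegralRep.integrand_restrict, hr₁i (hTS hv)]
    · -- an adapted conic wall
      have hTw : ∀ v ∈ T, v ∈ S ∧ 0 < ζ v ∧ (a : ℝ) * ζ v ^ 2 + c =
          ((q j).k0 + ((q j).k1 + (q j).k2 * v 0) * (ζ v / pN κ₀ κ₁ (v 0))) ^ 2 := fun v hv => by
        obtain ⟨⟨hvS, hw⟩, hnz⟩ := hTA hv
        have hz : 0 < ζ v := ((hF v hvS).1).lt_of_ne fun h => hnz ⟨hvS, h.symm⟩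
        exact ⟨hvS, hz, hw⟩
      exact InBaker.psection_cwall' hκ₁ γ a c ha (q j) (S := T) ζ (hζ.mono hTS hT)
        (fun v hv => ((hF v (hTw v hv).1).2 (hTw v hv).2.1).1)
        (fun v hv => ⟨(hTw v hv).2.1, ((hF v (hTw v hv).1).2 (hTw v hv).2.1).2.1⟩)
        (fun v hv => (hTw v hv).2.2) _ subset_rfl fun v hv => by
          rw [KZ.IntegralRep.integrand_restrict, hr₁i (hTS hv)]

end Summit.KontsevichZagierPeriods.RootDecompWalshStrata.ConicDescent.BallCube

end
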